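import Literature.MathematicalPhysics.QuantumFieldTheory.Balaban1983to89.B6HolderPairWindowV1

/-!
# `Balaban1983to89.B6HolderPairGeometryV1` — T. Bałaban, *Propagators and renormalization transformations for lattice gauge theories. II*,
# Commun. Math. Phys. **96** (1984) 223–250 [Balaban1984PropagatorsII], Prop. 2.6 (2.137) p. 247 with (2.2) p. 224, (2.36) p. 229, (2.46) p. 231 and
# p. 238 (`T_□ = □̃³`): THE BLOCK GEOMETRY OF A HÖLDER PAIR NEAR A CUBE — for a cube `□`, a direction `ν` and fine bonds `x, x′` with `h_□ ≠ 0` at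
# `x`, `x + e_ν`, `x′` or `x′ + e_ν` and `|x − x′|_∞ ≤ L^{j₀(□)+1}`: (G0) the window labels of `x − v_□`, `x′ − v_□` differ by at most `|x − x′|_∞`
# coordinatewise; (G1) the output blocks `y(x)`, `y(x′)` have levels in `{j₀, j₀ + 1}`; (G2) `d_T(y(x), y(x′)) ≤ (d + 1)(L + 1)`; (G3) the placement
# `y(x′) ∈ □⁺ ⟹ y(x) ∈ □̃`

statement-level skeleton of published theorems with citation tags; proofs where landed; nothing here is a claim about the Yang–Mills mass gap

PDF held: `paper:balaban1984-cmp96-propagators-rt-ii` (journal page = PDF page + 222): p. 224 [PDF 2] (2.2) (the layers `Λ_j` and their separation),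
p. 229 [PDF 7] (2.36) (the cubes `□` of size `2ML^jη`), p. 231 [PDF 9] (2.46) (the distance `d(y, y′)` of admissible contours), p. 238 [PDF 16] (`T_□`),
p. 247 [PDF 25] Prop. 2.6 (2.137) — re-read this generation on the ×2 render `b2b-balaban-ref1/pages/1984-cmp96-propagators-rt-II/…-p025-x2.png`:
*"‖ζ∇GJ‖_α, ‖ζG∇*J‖_α ≤ O(1)(Lʲη)^{1−α}(‖ζ‖^ξ_α + |ζ|)e^{−δ₃d(y,y′)}|J|, ξ = L^{−j} (2.137) for 0 ≤ α < 1, ζ ∈ C₀^∞(Δ̃(y)) (the cube Δ̃(y) for y ∈ Λ_j is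
a sum of 2^d unit cubes on the L^{−j}-scale, having y as a corner)"*; [4] = *… I*, CMP **95** (1984) (1.109) p. 35 (the Hölder quotient over pairs
`|x − x′| ≤ 1` at the scale `ξ`).

CITATION HEADER (lean-in-tree rule) — WHAT IS REPRODUCED.  Phase-2 file of the `lit-balaban` typed skeleton (HOME `run/shared/lean/pub/lit-balaban/`), seat
**p22 gen 28**, free target (2.137)₁ at k levels (HOME/STATUS TAKING 2026-08-23T22:15Z; the p22/p38 interface of 2026-08-23T23:54Z, items (b)(c) as
announced by p22 g27 01:39Z); SKELETON row **B6.Prop2.6** (cells only; decls of record untouched).  THE READING.  Print localises the output of (2.137)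
by the block `y` with `x, x′ ∈ Δ̃(y)`; the tree reads the pair at the output block `y(x)` of its first point (`…B6Prop26HolderGradKLevelV1`), and the
second point `x′` of an admissible pair lies within one block side of `x`.  The walk (2.141) is summed cube by cube; on a cube `□` where the pair is
ACTIVE (`h_□ ≠ 0` at one of `x, x + e_ν, x′, x′ + e_ν`) both points lie in the window of the member `T_□` (this seat's `…B6HolderPairWindowV1.pair_window`),
and the window is two-level (`…B6CubeInDecayV1.hlev_full`, print's (2.2): `T_□ = □̃³` meets `Λ_{j₀}` and `Λ_{j₀+1}` only).  This file draws the
consequences the assembly of (2.137)₁ needs to move bounds between `y(x)` and `y(x′)` and to place `y(x)`: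
* §1 `pair_labels` (G0): the window labels of `x − v_□` and `x′ − v_□` differ coordinatewise by at most `|x − x′|_∞` (no wrap of the global torus
  inside the window);
* §2 `pair_levels` (G1): `j₀ ≤ lev y(x) ≤ j₀ + 1` and the same for `x′` — the level comparability `|lev y(x) − lev y(x′)| ≤ 1` of the pair;
* §3 `pair_distT_le` (G2): `d_T(y(x), y(x′)) ≤ (d + 1)(L + 1)` — the chart staircase `…B6Geom246MultiLevelBox.dist_blkOf_le_box` at level `j₀` through
  the lattice box spanned by the two window points (inside the window, hence of level `≥ j₀`), read on the torus by `…B6TorusDepthDistance.distT_chart_eq`;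
* §4 `pair_placement` (G3): `y(x′) ∈ □⁺ ⟹ y(x) ∈ □̃` (`□⁺ = {centre ≤ 5S/4}`, the block radii `≤ S/16`, the pair adds `≤ S/8`: `3S/2 ≤ 7S/4`).
IMPORTS BY NAME, restating nothing (`pair_window`, `hlev_full`, `dist_blkOf_le_box`, `distT_chart_eq`, `blkV1_translate`); THEOREMS ONLY (no `def`,
no `def … : Prop`, no new hypothesis); standard axioms.

HONEST SCOPE / DIVERGENCES.  (1) Pure lattice geometry of the tree's V1 torus dictionary (blocks, levels, the cube charts); print has no
corresponding numbered statement — the facts are implicit in *"x, x′ ∈ Δ̃(y)"* of (2.137) and in the two-level structure (2.2) of `T_□` p. 238;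
(2) hypotheses as in `pair_window`: `M_h = Lᵃ ≥ 8`, `R ≥ 2L²`, the cube placed, `k ≤ m + K`; the constants `(d + 1)(L + 1)`, `7/4` are not optimised;
(3) V1 torus only; nothing on d = 4 or the continuum; NOT summit progress.  Unit `lit-balaban-p22` (gen 28), 2026-08-24.

v1.1 (p22 gen 30, 2026-08-24): RESTORES p380205 AFTER THE 1ba272d340d8 OVERWRITE — this is the verbatim accepted text of p380205 (sha16
b24ab50cb4bc4121, ACCEPTED commit 29dd74e5950b, 15:06Z) with only this paragraph added; one batch later (15:07Z, commit 1ba272d340d8) a stray,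
unrecorded gen-27 proposal of this seat targeting the same path (p374642, created 2026-08-24T01:48:46Z, text sha16 cb554973b6248641: decls
`blkV1_eq_blkMap`, `distT_blkV1_eq`, `level_of_deep`, `labels_of_active`, `pair_levels` (other shape), `dist_blk_pair_le(_const)`,
`blkV1_mem_SbigT_of_near_ST`) landed and replaced it (last writer wins across deferred proposals).  Those eight declarations were referenced by no
tree file and are superseded by §1–§4 below; the consumers (this seat's `B6Ineq2137GradKLevelV1`, p38's brick 6/7) import the names below.
-/

namespace Literature.MathematicalPhysics.QuantumFieldTheory.Balaban1983to89.B6HolderPairGeometryV1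

open Finset
open LatticeFieldCalculus
open B4ContourShift (supNorm exists_supNorm_eq)
open B4Reflection242 (boxDom)
open B6MultiLevelBoxOperator (N0 bigSide one_le_bigSide)
open B6MultiLevelTorusOperator (TDomains)
open B6Cover236MultiLevelBlocks (cubes Q mem_Q ctr side)
open B6Partition118KLevelFineLip (Qbig mem_Qbig)
open B6Geom246MultiLevelBox (bset blkOf bond toR cen dist_toR_cen_le supNorm_eq_dist lev_eq_of_blkOf_eq dist_blkOf_le_box)
open B6Geom246MultiLevelTorus (geomT bondT blkMap blkMap_injective distT_le_dist_box)
open B6TorusDepthDistance (distT_chart_eq)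
open B6Eq238MultiLevelTorus (svec)
open B6Partition118KLevelTorusCentral (Dch cc QT QbigT side_cc one_le_of_four_le)
open B6GlobalChartV1 (PV toBox toBox_apply blkV1 domT)
open B6AgreeLapV1Chart (DeepS deepS_mono)
open B6Prop25TwoScaleCensus (TSIdx)
open B6SectAOperatorsV1 (BondIdx)
open B6TranslateTorusV1 (vch blkV1_translate blkMap_fst)
open B6Prop26KLevelSkeletonV1 (hB ST mem_ST)
open B6Prop26KLevelSkeletonV2 (SbigT mem_SbigT)
open B6CubeWindowV1 (tC tC_j x0 hx0 hfit wC Placed j0 j0_le_level)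
open B6CubeInDecayV1 (hlev_full)
open B6HolderPairWindowV1 (pair_window deep_of_hB_ne_zero deep_of_hB_shift_ne_zero deepS_of_supDist_le supDist_translate)

variable {d ℓ : ℕ} {hd : 1 ≤ d + 1} {hL : Odd (ℓ + 1) ∧ 1 < ℓ + 1} {m K : ℕ} {Mh k R : ℕ} {P' : Fin (d + 1) → ℕ}

/-! ## §0  The chart frame of a cube: bonds translated by `−v_□`, their labels and blocks -/

section Chart

variable (hN : ∀ μ, N0 ℓ Mh k P' μ = (PV d ℓ m K hd hL).sitesPerDir 0) (D : TDomains d ℓ Mh k P' R)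

/-- `(x − v) + v = x` for bonds. [folklore] -/
private theorem translate_neg_add (v : Site (PV d ℓ m K hd hL) 0) (x : PBond (PV d ℓ m K hd hL) 0) :
    (x.translate (-v)).translate v = x := by
  rw [PBond.translate_translate, neg_add_cancel]; cases x; simp [PBond.translate]

/-- **THE OUTPUT BLOCK THROUGH THE CHART OF A CUBE**: `y(x)` is the torus image of the chart block of `x − v_□`.
[cite: Balaban1984PropagatorsII, (2.19)–(2.22) p.226, p.229 (translations of the torus), dictionary (charts)] -/
theorem blkV1_eq_blkMap_chart (hMh1 : 1 ≤ Mh) (hP : ∀ μ, 1 ≤ P' μ) (c : ↥(cubes D.toDomains)) (x : PBond (PV d ℓ m K hd hL) 0) :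
    blkV1 hN D x = blkMap D (svec ℓ k c.1.1 c.1.2)
      (blkV1 hN (D.chart (svec ℓ k c.1.1 c.1.2)) (x.translate (-vch Mh k (svec ℓ k c.1.1 c.1.2)))) := by
  conv_lhs => rw [← translate_neg_add (vch Mh k (svec ℓ k c.1.1 c.1.2)) x]
  exact blkV1_translate hN D hMh1 hP (svec ℓ k c.1.1 c.1.2) _

/-- the level of `y(x)` is the chart level of the chart point of `x − v_□`. [cite: Balaban1984PropagatorsII, (2.3)–(2.4) p.224, dictionary (charts)] -/
theorem level_blkV1_eq_chart_lev (hMh1 : 1 ≤ Mh) (hP : ∀ μ, 1 ≤ P' μ) (c : ↥(cubes D.toDomains)) (x : PBond (PV d ℓ m K hd hL) 0) :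
    (blkV1 hN D x).1.1 = (Dch D c).lev (toBox hN (x.translate (-vch Mh k (svec ℓ k c.1.1 c.1.2))).src).1 := by
  rw [blkV1_eq_blkMap_chart hN D hMh1 hP c x, blkMap_fst D hMh1 hP]
  exact (lev_eq_of_blkOf_eq (D := Dch D c) rfl).symm

/-- a `1`-deep window site satisfies the window inequalities of `hlev_full`. [cite: Balaban1984PropagatorsII, p.238 (T_□), bookkeeping] -/
theorem window_of_deepOne {a₀ a₁ : ℝ} {t : TSIdx d (ℓ + 1) hd hL a₀ a₁} {x₀ : Fin (d + 1) → ℤ} {z : Site (PV d ℓ m K hd hL) 0}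
    (hz : z ∈ DeepS t x₀ 1) : ∀ μ, x₀ μ ≤ (toBox hN z).1 μ ∧ (toBox hN z).1 μ < x₀ μ + (t.P.sitesPerDir 0 : ℕ) := by
  intro μ
  obtain ⟨h1, h2⟩ := hz μ
  push_cast at h1 h2
  exact ⟨by show x₀ μ ≤ (((z μ).val : ℕ) : ℤ); omega, by show (((z μ).val : ℕ) : ℤ) < _; omega⟩

/-- sites of the lattice box spanned by two `1`-deep window sites satisfy the window inequalities. [cite: Balaban1984PropagatorsII, p.238 (T_□), bookkeeping] -/
theorem window_of_hull {a₀ a₁ : ℝ} {t : TSIdx d (ℓ + 1) hd hL a₀ a₁} {x₀ : Fin (d + 1) → ℤ} {z z' : Site (PV d ℓ m K hd hL) 0}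
    (hz : z ∈ DeepS t x₀ 1) (hz' : z' ∈ DeepS t x₀ 1) {w : Fin (d + 1) → ℤ}
    (hw : ∀ μ, min ((toBox hN z).1 μ) ((toBox hN z').1 μ) ≤ w μ ∧ w μ ≤ max ((toBox hN z).1 μ) ((toBox hN z').1 μ)) :
    ∀ μ, x₀ μ ≤ w μ ∧ w μ < x₀ μ + (t.P.sitesPerDir 0 : ℕ) := by
  intro μ
  obtain ⟨a1, a2⟩ := window_of_deepOne hN hz μ
  obtain ⟨b1, b2⟩ := window_of_deepOne hN hz' μ
  obtain ⟨c1, c2⟩ := hw μ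
  exact ⟨le_trans (le_min a1 b1) c1, lt_of_le_of_lt c2 (max_lt a2 b2)⟩

end Chart

/-! ## §1  (G0) The window labels of an active near pair -/

section Pair

variable (hN : ∀ μ, N0 ℓ Mh k P' μ = (PV d ℓ m K hd hL).sitesPerDir 0) (D : TDomains d ℓ Mh k P' R) (hk : k ≤ m + K)
  {hMh1 : 1 ≤ Mh} {hP4 : ∀ μ, 4 ≤ P' μ} {a : ℕ} (hMha : Mh = (ℓ + 1) ^ a) (c : ↥(cubes D.toDomains))

include hk hMha in
/-- **(G0) THE WINDOW LABELS OF AN ACTIVE NEAR PAIR DIFFER BY AT MOST `|x − x′|_∞`** (`M_h = Lᵃ ≥ 8`, `R ≥ 2L²`, cube placed): if `h_□ ≠ 0` at `x`,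
`x + e_ν`, `x′` or `x′ + e_ν` and `|x − x′|_∞ ≤ L^{j₀+1}`, then for every coordinate `μ` the labels of `x − v_□` and `x′ − v_□` differ by at most
`|x − x′|_∞` (the active point is `4L^{j₀+1} − 1`-deep in the window, so the pair does not wrap around the global torus).
[cite: Balaban1984PropagatorsII, Prop. 2.6 (2.137) p.247 (x, x′ ∈ Δ̃(y)), p.238 (T_□ = □̃³ with periodicity conditions); Balaban1984PropagatorsI, (1.109) p.35] -/
theorem pair_labels (hM8 : 8 ≤ Mh) (hR2 : 2 * (ℓ + 1) ^ 2 ≤ R) (hpl : Placed ℓ k P' c.1) (ν : Fin (d + 1))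
    {x x' : PBond (PV d ℓ m K hd hL) 0}
    (hact : hB hN D c x ≠ 0 ∨ hB hN D c ⟨x.src.shift ν, x.dir⟩ ≠ 0 ∨ hB hN D c x' ≠ 0 ∨ hB hN D c ⟨x'.src.shift ν, x'.dir⟩ ≠ 0)
    (hdist : supDist x.src x'.src ≤ (ℓ + 1) ^ (j0 hMh1 hP4 c + 1)) :
    ∀ μ, |((((x'.translate (-vch Mh k (svec ℓ k c.1.1 c.1.2))).src μ).val : ℕ) : ℤ) -
        ((((x.translate (-vch Mh k (svec ℓ k c.1.1 c.1.2))).src μ).val : ℕ) : ℤ)| ≤ (supDist x.src x'.src : ℕ) := by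
  have hfit' := hfit hN hMh1 hP4 hMha c (le_refl (0 : ℝ)) hpl
  have hx0' := hx0 (ℓ := ℓ) (Mh := Mh) (k := k) hpl
  set v := vch (d := d) (ℓ := ℓ) (hd := hd) (hL := hL) (m := m) (K := K) Mh k (svec ℓ k c.1.1 c.1.2) with hv
  have hs : supDist (x.translate (-v)).src (x'.translate (-v)).src = supDist x.src x'.src := supDist_translate _ _ _
  have hs' : supDist (x'.translate (-v)).src (x.translate (-v)).src = supDist x.src x'.src := by
    rw [B3TorusRadialSums.supDist_comm]; exact hs
  have hN1 : 1 ≤ (ℓ + 1) ^ (j0 hMh1 hP4 c + 1) := Nat.one_le_pow _ _ (Nat.succ_pos ℓ)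
  have hle1 : 0 + supDist (x.translate (-v)).src (x'.translate (-v)).src ≤ 4 * (ℓ + 1) ^ (j0 hMh1 hP4 c + 1) := by rw [hs]; omega
  have hle2 : 0 + supDist (x.translate (-v)).src (x'.translate (-v)).src ≤ 4 * (ℓ + 1) ^ (j0 hMh1 hP4 c + 1) - 1 := by rw [hs]; omega
  have hle3 : 0 + supDist (x'.translate (-v)).src (x.translate (-v)).src ≤ 4 * (ℓ + 1) ^ (j0 hMh1 hP4 c + 1) := by rw [hs']; omega
  have hle4 : 0 + supDist (x'.translate (-v)).src (x.translate (-v)).src ≤ 4 * (ℓ + 1) ^ (j0 hMh1 hP4 c + 1) - 1 := by rw [hs']; omega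
  rcases hact with h | h | h | h
  · have hz := deep_of_hB_ne_zero hN hk hMh1 hP4 hMha c (le_refl (0 : ℝ)) hM8 hR2 (fun _ => 0) 0 h
    have hl := (deepS_of_supDist_le hx0' hfit' (deepS_mono hle1 hz) le_rfl).2
    intro μ; rw [← hs]; exact hl μ
  · have hz := deep_of_hB_shift_ne_zero hN hk hMh1 hP4 hMha c (le_refl (0 : ℝ)) hM8 hR2 hpl (fun _ => 0) 0 ν h
    have hl := (deepS_of_supDist_le hx0' hfit' (deepS_mono hle2 hz) le_rfl).2
    intro μ; rw [← hs]; exact hl μ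
  · have hz := deep_of_hB_ne_zero hN hk hMh1 hP4 hMha c (le_refl (0 : ℝ)) hM8 hR2 (fun _ => 0) 0 h
    have hl := (deepS_of_supDist_le hx0' hfit' (deepS_mono hle3 hz) le_rfl).2
    intro μ; rw [← hs', abs_sub_comm]; exact hl μ
  · have hz := deep_of_hB_shift_ne_zero hN hk hMh1 hP4 hMha c (le_refl (0 : ℝ)) hM8 hR2 hpl (fun _ => 0) 0 ν h
    have hl := (deepS_of_supDist_le hx0' hfit' (deepS_mono hle4 hz) le_rfl).2
    intro μ; rw [← hs', abs_sub_comm]; exact hl μ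

include hk hMha in
/-- the chart points of an active near pair are at chart sup-distance `≤ |x − x′|_∞`. [cite: Balaban1984PropagatorsII, Prop. 2.6 (2.137) p.247, p.238 (T_□), bookkeeping] -/
theorem pair_supNorm_le (hM8 : 8 ≤ Mh) (hR2 : 2 * (ℓ + 1) ^ 2 ≤ R) (hpl : Placed ℓ k P' c.1) (ν : Fin (d + 1))
    {x x' : PBond (PV d ℓ m K hd hL) 0}
    (hact : hB hN D c x ≠ 0 ∨ hB hN D c ⟨x.src.shift ν, x.dir⟩ ≠ 0 ∨ hB hN D c x' ≠ 0 ∨ hB hN D c ⟨x'.src.shift ν, x'.dir⟩ ≠ 0)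
    (hdist : supDist x.src x'.src ≤ (ℓ + 1) ^ (j0 hMh1 hP4 c + 1)) :
    supNorm ((toBox hN (x.translate (-vch Mh k (svec ℓ k c.1.1 c.1.2))).src).1 -
        (toBox hN (x'.translate (-vch Mh k (svec ℓ k c.1.1 c.1.2))).src).1) ≤ ((supDist x.src x'.src : ℕ) : ℝ) := by
  have hlab := pair_labels hN D hk hMha c hM8 hR2 hpl ν hact hdist
  obtain ⟨i, hi⟩ := exists_supNorm_eq ((toBox hN (x.translate (-vch Mh k (svec ℓ k c.1.1 c.1.2))).src).1 -
    (toBox hN (x'.translate (-vch Mh k (svec ℓ k c.1.1 c.1.2))).src).1)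
  have h' : |((toBox hN (x.translate (-vch Mh k (svec ℓ k c.1.1 c.1.2))).src).1 -
      (toBox hN (x'.translate (-vch Mh k (svec ℓ k c.1.1 c.1.2))).src).1) i| ≤ ((supDist x.src x'.src : ℕ) : ℤ) := by
    rw [Pi.sub_apply, abs_sub_comm]; exact hlab i
  rw [hi]
  exact_mod_cast h'

/-! ## §2  (G1) The levels of the two output blocks -/

include hk hMha in
/-- **(G1) THE OUTPUT BLOCKS OF AN ACTIVE NEAR PAIR HAVE LEVELS `j₀` OR `j₀ + 1`** (`M_h = Lᵃ ≥ 8`, `R ≥ 2L²`, cube placed): if `h_□ ≠ 0` at `x`,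
`x + e_ν`, `x′` or `x′ + e_ν` and `|x − x′|_∞ ≤ L^{j₀+1}`, then `j₀(□) ≤ lev y(x) ≤ j₀(□) + 1` and `j₀(□) ≤ lev y(x′) ≤ j₀(□) + 1` — in particular the
levels of `y(x)` and `y(x′)` differ by at most one (both points lie in the two-level window `T_□ = □̃³`).
[cite: Balaban1984PropagatorsII, Prop. 2.6 (2.137) p.247 (x, x′ ∈ Δ̃(y), y ∈ Λ_j), (2.2) p.224, p.238 (T_□ = □̃³); Balaban1984PropagatorsI, (1.109) p.35] -/
theorem pair_levels (hM8 : 8 ≤ Mh) (hR2 : 2 * (ℓ + 1) ^ 2 ≤ R) (hpl : Placed ℓ k P' c.1) (ν : Fin (d + 1))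
    {x x' : PBond (PV d ℓ m K hd hL) 0}
    (hact : hB hN D c x ≠ 0 ∨ hB hN D c ⟨x.src.shift ν, x.dir⟩ ≠ 0 ∨ hB hN D c x' ≠ 0 ∨ hB hN D c ⟨x'.src.shift ν, x'.dir⟩ ≠ 0)
    (hdist : supDist x.src x'.src ≤ (ℓ + 1) ^ (j0 hMh1 hP4 c + 1)) :
    (j0 hMh1 hP4 c ≤ (blkV1 hN D x).1.1 ∧ (blkV1 hN D x).1.1 ≤ j0 hMh1 hP4 c + 1) ∧
      (j0 hMh1 hP4 c ≤ (blkV1 hN D x').1.1 ∧ (blkV1 hN D x').1.1 ≤ j0 hMh1 hP4 c + 1) := by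
  have hP : ∀ μ, 1 ≤ P' μ := one_le_of_four_le hP4
  obtain ⟨hw, hw', -⟩ := pair_window hN hk hMh1 hP4 hMha c (le_refl (0 : ℝ)) hM8 hR2 hpl (fun _ => 0) 0 ν hact hdist
  have key : ∀ {z : PBond (PV d ℓ m K hd hL) 0},
      (z.translate (-vch Mh k (svec ℓ k c.1.1 c.1.2))).src ∈
        DeepS (tC hN hk hMh1 hP4 c (le_refl (0 : ℝ)) a (wC hN hk c fun _ => 0) 0) (x0 ℓ Mh k c.1) 1 →
      j0 hMh1 hP4 c ≤ (blkV1 hN D z).1.1 ∧ (blkV1 hN D z).1.1 ≤ j0 hMh1 hP4 c + 1 := by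
    intro z hz
    rw [level_blkV1_eq_chart_lev hN D hMh1 hP c z]
    exact hlev_full hN hk hMh1 hP4 hMha c (le_refl (0 : ℝ)) hR2 (wC hN hk c fun _ => 0) 0 _ (toBox hN _).2 (window_of_deepOne hN hz)
  exact ⟨key hw, key hw'⟩

/-! ## §3  (G2) The torus distance of the two output blocks -/

include hk hMha in
/-- **(G2) THE OUTPUT BLOCKS OF AN ACTIVE NEAR PAIR ARE `d_T`-CLOSE**: if `h_□ ≠ 0` at `x`, `x + e_ν`, `x′` or `x′ + e_ν` and `|x − x′|_∞ ≤ L^{j₀+1}`,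
then `d_T(y(x), y(x′)) ≤ (d + 1)(L + 1)` — the staircase of admissible bonds through the lattice box spanned by the two window points (all of
level `≥ j₀`, so at most `|x − x′|_∞/L^{j₀} + 1 ≤ L + 1` blocks per direction), read on the torus through the chart.
[cite: Balaban1984PropagatorsII, (2.46) p.231 (d(y, y′)), p.231–232 («d(x, x′) = d(y, y′) if x ∈ B^j(y) …»), (2.2) p.224, p.238 (T_□); Prop. 2.6 (2.137) p.247] -/
theorem pair_distT_le (hM8 : 8 ≤ Mh) (hR2 : 2 * (ℓ + 1) ^ 2 ≤ R) (hpl : Placed ℓ k P' c.1) (ν : Fin (d + 1))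
    {x x' : PBond (PV d ℓ m K hd hL) 0}
    (hact : hB hN D c x ≠ 0 ∨ hB hN D c ⟨x.src.shift ν, x.dir⟩ ≠ 0 ∨ hB hN D c x' ≠ 0 ∨ hB hN D c ⟨x'.src.shift ν, x'.dir⟩ ≠ 0)
    (hdist : supDist x.src x'.src ≤ (ℓ + 1) ^ (j0 hMh1 hP4 c + 1)) :
    (geomT D).dist (blkV1 hN D x) (blkV1 hN D x') ≤ ((d : ℝ) + 1) * (((ℓ : ℝ) + 1) + 1) := by
  have hP : ∀ μ, 1 ≤ P' μ := one_le_of_four_le hP4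
  obtain ⟨hw, hw', -⟩ := pair_window hN hk hMh1 hP4 hMha c (le_refl (0 : ℝ)) hM8 hR2 hpl (fun _ => 0) 0 ν hact hdist
  have hsup := pair_supNorm_le hN D hk hMha c hM8 hR2 hpl ν hact hdist
  set sv := svec (d := d) ℓ k c.1.1 c.1.2 with hsv
  set u : ↥(boxDom (N0 ℓ Mh k P')) := toBox hN (x.translate (-vch Mh k sv)).src with hu
  set u' : ↥(boxDom (N0 ℓ Mh k P')) := toBox hN (x'.translate (-vch Mh k sv)).src with hu'
  -- the torus distance of the two output blocks is the chart distance of the two chart blocks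
  have e1 : (geomT D).dist (blkV1 hN D x) (blkV1 hN D x') =
      (((bondT (D.chart sv)).dist (blkOf (Dch D c) u) (blkOf (Dch D c) u') : ℕ) : ℝ) := by
    show (((bondT D).dist (blkV1 hN D x) (blkV1 hN D x') : ℕ) : ℝ) = _
    rw [blkV1_eq_blkMap_chart hN D hMh1 hP c x, blkV1_eq_blkMap_chart hN D hMh1 hP c x', distT_chart_eq hMh1 hP]
    rfl
  -- … at most the box distance of the chart, bounded by the staircase at level `j₀`
  have h2 : (bondT (D.chart sv)).dist (blkOf (Dch D c) u) (blkOf (Dch D c) u') ≤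
      (bond (Dch D c)).dist (blkOf (Dch D c) u) (blkOf (Dch D c) u') :=
    distT_le_dist_box (D.chart sv) hMh1 hP _ _
  have h3 := dist_blkOf_le_box (D := Dch D c) hMh1 hP (i := j0 hMh1 hP4 c) u u' fun z hz hhull =>
    (hlev_full hN hk hMh1 hP4 hMha c (le_refl (0 : ℝ)) hR2 (wC hN hk c fun _ => 0) 0 z hz (window_of_hull hN hw hw' hhull)).1
  -- `|u − u′|_∞ ≤ |x − x′|_∞ ≤ L^{j₀+1}`
  have hLj : (0 : ℝ) < (((ℓ + 1) ^ j0 hMh1 hP4 c : ℕ) : ℝ) := by positivity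
  have hq : supNorm (u.1 - u'.1) / (((ℓ + 1) ^ j0 hMh1 hP4 c : ℕ) : ℝ) ≤ (ℓ : ℝ) + 1 := by
    rw [div_le_iff₀ hLj]
    have h1 : (((supDist x.src x'.src : ℕ)) : ℝ) ≤ (((ℓ + 1) ^ (j0 hMh1 hP4 c + 1) : ℕ) : ℝ) := by exact_mod_cast hdist
    push_cast at h1 ⊢
    calc supNorm (u.1 - u'.1) ≤ ((supDist x.src x'.src : ℕ) : ℝ) := hsup
      _ ≤ ((ℓ : ℝ) + 1) ^ (j0 hMh1 hP4 c + 1) := h1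
      _ = ((ℓ : ℝ) + 1) * ((ℓ : ℝ) + 1) ^ j0 hMh1 hP4 c := by ring
  have hd0 : (0 : ℝ) ≤ (d : ℝ) + 1 := by positivity
  calc (geomT D).dist (blkV1 hN D x) (blkV1 hN D x')
      = (((bondT (D.chart sv)).dist (blkOf (Dch D c) u) (blkOf (Dch D c) u') : ℕ) : ℝ) := e1
    _ ≤ (((bond (Dch D c)).dist (blkOf (Dch D c) u) (blkOf (Dch D c) u') : ℕ) : ℝ) := by exact_mod_cast h2
    _ ≤ ((d : ℝ) + 1) * (supNorm (u.1 - u'.1) / (((ℓ + 1) ^ j0 hMh1 hP4 c : ℕ) : ℝ) + 1) := by exact_mod_cast h3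
    _ ≤ ((d : ℝ) + 1) * (((ℓ : ℝ) + 1) + 1) := mul_le_mul_of_nonneg_left (by linarith) hd0

/-! ## §4  (G3) The placement `y(x′) ∈ □⁺ ⟹ y(x) ∈ □̃` -/

include hk hMha in
/-- **(G3) THE PLACEMENT OF AN ACTIVE NEAR PAIR**: if `h_□ ≠ 0` at `x`, `x + e_ν`, `x′` or `x′ + e_ν`, `|x − x′|_∞ ≤ L^{j₀+1}` and `y(x′) ∈ □⁺`, then
`y(x) ∈ □̃` (`L ≥ 2`): the centre of `y(x′)` is within `5S/4` of the centre of `□`, the two block radii are `≤ (L^{j₀+1} − 1)/2 ≤ S/16`, the pair adds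
`|x − x′|_∞ ≤ L^{j₀+1} ≤ S/8`, and `5S/4 + S/16 + S/8 + S/16 = 3S/2 ≤ 7S/4`, the radius of `□̃`.
[cite: Balaban1984PropagatorsII, Prop. 2.6 (2.137) p.247 (x, x′ ∈ Δ̃(y)), (2.36) p.229, p.235 (□⁺), p.239 («ζ_□ ∈ C₀^∞(□̃)»); Balaban1984PropagatorsI, (1.109) p.35] -/
theorem pair_placement (hM8 : 8 ≤ Mh) (hR2 : 2 * (ℓ + 1) ^ 2 ≤ R) (hpl : Placed ℓ k P' c.1) (ν : Fin (d + 1))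
    {x x' : PBond (PV d ℓ m K hd hL) 0}
    (hact : hB hN D c x ≠ 0 ∨ hB hN D c ⟨x.src.shift ν, x.dir⟩ ≠ 0 ∨ hB hN D c x' ≠ 0 ∨ hB hN D c ⟨x'.src.shift ν, x'.dir⟩ ≠ 0)
    (hdist : supDist x.src x'.src ≤ (ℓ + 1) ^ (j0 hMh1 hP4 c + 1)) (hx' : blkV1 hN D x' ∈ ST D hMh1 hP4 c) :
    blkV1 hN D x ∈ SbigT D hMh1 hP4 c := by
  have hP : ∀ μ, 1 ≤ P' μ := one_le_of_four_le hP4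
  obtain ⟨hw, hw', -⟩ := pair_window hN hk hMh1 hP4 hMha c (le_refl (0 : ℝ)) hM8 hR2 hpl (fun _ => 0) 0 ν hact hdist
  have hsup := pair_supNorm_le hN D hk hMha c hM8 hR2 hpl ν hact hdist
  set sv := svec (d := d) ℓ k c.1.1 c.1.2 with hsv
  set u : ↥(boxDom (N0 ℓ Mh k P')) := toBox hN (x.translate (-vch Mh k sv)).src with hu
  set u' : ↥(boxDom (N0 ℓ Mh k P')) := toBox hN (x'.translate (-vch Mh k sv)).src with hu'
  -- pull `y(x′) ∈ □⁺` back to the chart: the chart block of `u′` is in `Q`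
  have h1 : blkV1 hN D x' ∈ QT D hMh1 hP4 c := (mem_ST D hMh1 hP4 c _).1 hx'
  rw [blkV1_eq_blkMap_chart hN D hMh1 hP c x'] at h1
  obtain ⟨b, hb, he⟩ := Finset.mem_image.1 h1
  rw [blkMap_injective hMh1 hP sv he] at hb
  have hQ : blkOf (Dch D c) u' ∈ Q (Dch D c) (cc D hMh1 hP4 c) := hb
  -- the goal in the chart: the chart block of `u` is in `Qbig`
  show blkV1 hN D x ∈ QbigT D hMh1 hP4 c
  rw [blkV1_eq_blkMap_chart hN D hMh1 hP c x]
  show blkMap D sv (blkOf (Dch D c) u) ∈ (Qbig (Dch D c) (cc D hMh1 hP4 c)).image (blkMap D sv)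
  refine Finset.mem_image_of_mem _ ((mem_Qbig (Dch D c)).2 ?_)
  -- sizes: `S = M_h L^{j+1} ≥ 8L^{j+1} ≥ 8L^{j₀+1}`, levels of the two chart blocks `≤ j₀ + 1`
  have hS : side (Dch D c) (cc D hMh1 hP4 c) = (bigSide ℓ Mh c.1.1 : ℝ) := side_cc hMh1 hP4 c
  have hj := (j0_le_level (D := D) (hMh1 := hMh1) (hP4 := hP4) (c := c) hL hR2).1
  have hL1 : 1 ≤ ℓ + 1 := Nat.succ_pos ℓ
  have hlu := (hlev_full hN hk hMh1 hP4 hMha c (le_refl (0 : ℝ)) hR2 (wC hN hk c fun _ => 0) 0 u.1 u.2 (window_of_deepOne hN hw)).2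
  have hlu' := (hlev_full hN hk hMh1 hP4 hMha c (le_refl (0 : ℝ)) hR2 (wC hN hk c fun _ => 0) 0 u'.1 u'.2 (window_of_deepOne hN hw')).2
  have elu : (Dch D c).lev u.1 = (blkOf (Dch D c) u).1.1 := lev_eq_of_blkOf_eq (D := Dch D c) rfl
  have elu' : (Dch D c).lev u'.1 = (blkOf (Dch D c) u').1.1 := lev_eq_of_blkOf_eq (D := Dch D c) rfl
  have hpu : (((ℓ + 1) ^ (blkOf (Dch D c) u).1.1 : ℕ) : ℝ) ≤ (((ℓ + 1) ^ (c.1.1 + 1) : ℕ) : ℝ) := by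
    have h : (blkOf (Dch D c) u).1.1 ≤ c.1.1 + 1 := by
      rw [← elu]; exact hlu.trans (by simp only [tC_j]; omega)
    exact_mod_cast Nat.pow_le_pow_right hL1 h
  have hpu' : (((ℓ + 1) ^ (blkOf (Dch D c) u').1.1 : ℕ) : ℝ) ≤ (((ℓ + 1) ^ (c.1.1 + 1) : ℕ) : ℝ) := by
    have h : (blkOf (Dch D c) u').1.1 ≤ c.1.1 + 1 := by
      rw [← elu']; exact hlu'.trans (by simp only [tC_j]; omega)
    exact_mod_cast Nat.pow_le_pow_right hL1 h
  have h8 : 8 * (((ℓ + 1) ^ (c.1.1 + 1) : ℕ) : ℝ) ≤ (bigSide ℓ Mh c.1.1 : ℝ) := by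
    unfold bigSide; push_cast
    have : (8 : ℝ) ≤ Mh := by exact_mod_cast hM8
    have hp : (0 : ℝ) ≤ ((ℓ : ℝ) + 1) ^ (c.1.1 + 1) := by positivity
    nlinarith
  have hsd : (((supDist x.src x'.src : ℕ)) : ℝ) ≤ (((ℓ + 1) ^ (c.1.1 + 1) : ℕ) : ℝ) := by
    have h : supDist x.src x'.src ≤ (ℓ + 1) ^ (c.1.1 + 1) := hdist.trans (Nat.pow_le_pow_right hL1 (by omega))
    exact_mod_cast h
  -- distances in the chart
  have hr := dist_toR_cen_le (Dch D c) (rfl : blkOf (Dch D c) u = blkOf (Dch D c) u)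
  have hr' := dist_toR_cen_le (Dch D c) (rfl : blkOf (Dch D c) u' = blkOf (Dch D c) u')
  have hcq : dist (cen (Dch D c) (blkOf (Dch D c) u')) (ctr (Dch D c) (cc D hMh1 hP4 c)) ≤ 5 / 4 * side (Dch D c) (cc D hMh1 hP4 c) :=
    (mem_Q (Dch D c)).1 hQ
  have huu : dist (toR u.1) (toR u'.1) ≤ ((supDist x.src x'.src : ℕ) : ℝ) := by rw [← supNorm_eq_dist]; exact hsup
  rw [hS] at hcq ⊢
  calc dist (cen (Dch D c) (blkOf (Dch D c) u)) (ctr (Dch D c) (cc D hMh1 hP4 c))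
      ≤ dist (toR u.1) (cen (Dch D c) (blkOf (Dch D c) u)) + dist (toR u.1) (ctr (Dch D c) (cc D hMh1 hP4 c)) := dist_triangle_left _ _ _
    _ ≤ dist (toR u.1) (cen (Dch D c) (blkOf (Dch D c) u)) + (dist (toR u.1) (toR u'.1) +
        (dist (toR u'.1) (cen (Dch D c) (blkOf (Dch D c) u')) + dist (cen (Dch D c) (blkOf (Dch D c) u')) (ctr (Dch D c) (cc D hMh1 hP4 c)))) := by
          linarith [dist_triangle (toR u.1) (toR u'.1) (ctr (Dch D c) (cc D hMh1 hP4 c)),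
            dist_triangle (toR u'.1) (cen (Dch D c) (blkOf (Dch D c) u')) (ctr (Dch D c) (cc D hMh1 hP4 c))]
    _ ≤ 7 / 4 * (bigSide ℓ Mh c.1.1 : ℝ) := by linarith

end Pair

end Literature.MathematicalPhysics.QuantumFieldTheory.Balaban1983to89.B6HolderPairGeometryV1
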